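import Summits.QuantumFields.YangMills.Theorems.ColdStartUniversalityLatticeLangevinFrameDerivativeTimeDerivative
import Summits.QuantumFields.YangMills.Theorems.ColdStartUniversalityLatticeLangevinWeightedCurvature
import Summits.QuantumFields.YangMills.Theorems.ColdStartUniversalityLatticeLangevinGradientBoundFlow
import HarnessLib

/-!
# Route `ColdStartUniversality` (fixed-cut-off package, Bakry–Émery side, WEIGHTED gradient bounds): the FLOW proof of the
# integrated weighted gradient bound `e^((2−K₀)t) ∫ H·Γ^c(κ_t F) dμ_(β') ≤ ∫ H·κ_t(Γ^c F) dμ_(β')`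

Helper file (seat `ym-line-csu-p1`, g43; `--supports stmt-QuantumFields-24809`).  SU(2) lattice Langevin (SZZ) dynamics at a fixed
cut-off, ANY realising Markov kernel family `κ`; a link weight `c ≥ 0` and the WEIGHTED carré du champ along the noise frame
`Γ^c(u)(x) = Σ_n c_(n.1) (W_n u)²(coords x)`; the weighted frame Hessian bound `hHess` with constant `K₀` (discharged for weights of
bounded plaquette ratio in the sequel `…WeightedHessian`).
★★★ `integral_mul_wcarre_transition_le_of_whessBound`: for `f ∈ C⁹_c`, `h ∈ C³_c` with `H = h∘coords ≥ 0` on the group, `t ≥ 0` and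
ANY `C¹` representative `g` of `κ_t(f∘coords)`:  `e^((2−K₀)t) · ∫ H·Γ^c(g) dμ_(β') ≤ ∫ H·κ_t(Γ^c f) dμ_(β')`.
PROOF — a genuine Bakry–Émery flow (the duality trick of g29's `…GradientBoundFlow`, which writes `Γ = 𝓛(u²) − 2u𝓛u` to avoid spatial
derivatives of the semigroup, is not available for a weighted carré du champ): `Λ(s) = ∫ κ_sH · Γ^c(κ_(t−s)F) dμ` is differentiated
using the TIME-REGULARITY OF THE FRAME DERIVATIVES of the semigroup (`hasDerivAt_frameDeriv_transitionRep`, g43), Dynkin for `κ_sH`,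
the `μ_(β')`-symmetry of `𝓛` on `C²` functions to move the generator onto `Γ^c(κ_(t−s)F)`, and the pointwise WEIGHTED curvature
inequality `generator_wcarre_sub_ge_of_whessBound`; then Grönwall on `[0,t]`, `κ_0 = id` and the `μ_(β')`-symmetry of `κ_t`.
THEOREMS ONLY, no definition, no sorry.  HONEST FRAMING: fixed cut-off; the rate `2 − K₀` is volume-independent but nothing here is
uniform along the route's scaling `β'_K → ∞`; no crux, rung or summit statement is proved; the Yang–Mills mass gap is NOT proved.
-/

set_option autoImplicit false

noncomputable section

namespace Summit.QuantumFields.YangMills.Theorems.ColdStartUniversality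

open MeasureTheory ProbabilityTheory Matrix Complex Finset Filter Set
open scoped ComplexConjugate BigOperators Matrix NNReal ENNReal Topology
open Literature.Probability.Process Literature.MathematicalPhysics.QuantumFieldTheory
open Literature.MathematicalPhysics.QuantumLattice (fundamentalRep fundamentalLatticeRep continuous_fundamentalRep fundamentalRep_apply)

variable {L : ℕ} [NeZero L]

/-- ★★★ **Integrated WEIGHTED gradient bound (Bakry–Émery flow) for the SZZ semigroup at a fixed cut-off.**  For a link weight
`c ≥ 0` satisfying the weighted frame Hessian bound `hHess` with constant `K₀`: for `f ∈ C⁹_c`, `h ∈ C³_c` with `h∘coords ≥ 0` on the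
group, any realising Markov kernel family `κ`, `t ≥ 0` and any `C¹` representative `g` of `κ_t(f∘coords)`,
`e^((2−K₀)t) · ∫ (h∘coords)·Σ_n c_(n.1)(W_n g)² dμ_(β') ≤ ∫ (h∘coords)(x)·(∫ Σ_n c_(n.1)(W_n f)² dκ_t x) dμ_(β')(x)`.
[cite: BakryGentilLedoux2014, Thm 3.3.18 and (3.2.4); ShenZhuZhu2022 §5 Lemma 5.1 / (5.13)] -/
theorem integral_mul_wcarre_transition_le_of_whessBound (L : ℕ) [NeZero L] (β' K₀ : ℝ) (c : Edge 3 L → ℝ) (hc0 : ∀ e, 0 ≤ c e)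
    (hHess : (∀ (V : (GaugeConfig 3 L (Matrix.specialUnitaryGroup (Fin 2) ℂ))) (Λ : (Edge 3 L × Fin (fundamentalLatticeRep 2).N × Fin (fundamentalLatticeRep 2).N × Bool → ℝ) →L[ℝ] ℝ),
      ∑ n : Edge 3 L × NoiseIdx (fundamentalLatticeRep 2).N, ∑ m : Edge 3 L × NoiseIdx (fundamentalLatticeRep 2).N,
        c n.1 * Λ ((fun q : Edge 3 L × Fin (fundamentalLatticeRep 2).N × Fin (fundamentalLatticeRep 2).N × Bool => if n.1 = q.1 then (fun z : ℂ => if q.2.2.2 then z.im else z.re) (((Real.sqrt 2 : ℂ) • ((fundamentalLatticeRep 2).lieProj (noiseDir n.2) * (fun (ee : Edge 3 L) => Matrix.of fun (i j : Fin (fundamentalLatticeRep 2).N) => (((fun (V : GaugeConfig 3 L (Matrix.specialUnitaryGroup (Fin 2) ℂ)) (q : Edge 3 L × Fin (fundamentalLatticeRep 2).N × Fin (fundamentalLatticeRep 2).N × Bool) => (fun z : ℂ => if q.2.2.2 then z.im else z.re) ((fundamentalRep (Fin 2) (V q.1) : Matrix (Fin 2) (Fin 2) ℂ) q.2.1 q.2.2.1))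 V (ee, i, j, false) : ℝ) : ℂ) + (((fun (V : GaugeConfig 3 L (Matrix.specialUnitaryGroup (Fin 2) ℂ)) (q : Edge 3 L × Fin (fundamentalLatticeRep 2).N × Fin (fundamentalLatticeRep 2).N × Bool) => (fun z : ℂ => if q.2.2.2 then z.im else z.re) ((fundamentalRep (Fin 2) (V q.1) : Matrix (Fin 2) (Fin 2) ℂ) q.2.1 q.2.2.1)) V (ee, i, j, true) : ℝ) : ℂ) * Complex.I) q.1)) q.2.1 q.2.2.1) else 0)) * Λ ((fun q : Edge 3 L × Fin (fundamentalLatticeRep 2).N × Fin (fundamentalLatticeRep 2).N × Bool => if m.1 = q.1 then (fun z : ℂ => if q.2.2.2 then z.im else z.re) (((Real.sqrt 2 : ℂ) • ((fundamentalLatticeRep 2).lieProj (noiseDir m.2) * (fun (ee : Edge 3 L) => Matrix.of fun (i j : Fin (fundamentalLatticeRep 2).N) => (((fun (V : GaugeConfig 3 L (Matrix.specialUnitaryGroup (Fin 2) ℂ)) (q : Edge 3 L × Fin (fundamentalLatticeRep 2).N × Fin (fundamentalLatticeRep 2).N × Bool) => (fun z : ℂ => if q.2.2.2 then z.im else z.re)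 ((fundamentalRep (Fin 2) (V q.1) : Matrix (Fin 2) (Fin 2) ℂ) q.2.1 q.2.2.1)) V (ee, i, j, false) : ℝ) : ℂ) + (((fun (V : GaugeConfig 3 L (Matrix.specialUnitaryGroup (Fin 2) ℂ)) (q : Edge 3 L × Fin (fundamentalLatticeRep 2).N × Fin (fundamentalLatticeRep 2).N × Bool) => (fun z : ℂ => if q.2.2.2 then z.im else z.re) ((fundamentalRep (Fin 2) (V q.1) : Matrix (Fin 2) (Fin 2) ℂ) q.2.1 q.2.2.1)) V (ee, i, j, true) : ℝ) : ℂ) * Complex.I) q.1)) q.2.1 q.2.2.1) else 0)) *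
          fderiv ℝ (fun z : (Edge 3 L × Fin (fundamentalLatticeRep 2).N × Fin (fundamentalLatticeRep 2).N × Bool → ℝ) => fderiv ℝ (fun y : (Edge 3 L × Fin (fundamentalLatticeRep 2).N × Fin (fundamentalLatticeRep 2).N × Bool → ℝ) => β' * ∑ p : Plaquette 3 L, (rootedLoop (fun (ee : Edge 3 L) (i j : Fin (fundamentalLatticeRep 2).N) => ((y (ee, i, j, false) : ℝ) : ℂ) + ((y (ee, i, j, true) : ℝ) : ℂ) * Complex.I) (p.1, p.2.1.1) p.2.1.2 false).trace.re) z (fun q : Edge 3 L × Fin (fundamentalLatticeRep 2).N × Fin (fundamentalLatticeRep 2).N × Bool => if m.1 = q.1 then (fun z : ℂ => if q.2.2.2 then z.im else z.re) (((Real.sqrt 2 : ℂ) • ((fundamentalLatticeRep 2).lieProj (noiseDir m.2) * (fun (ee : Edge 3 L) => Matrix.of fun (i j : Fin (fundamentalLatticeRep 2).N) => ((z (ee, i, j, false) : ℝ) : ℂ) + ((z (ee, i, j, true) : ℝ) : ℂ) * Complex.I) q.1)) q.2.1 q.2.2.1) else 0)) ((fun (V : GaugeConfig 3 L (Matrix.specialUnitaryGroup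 (Fin 2) ℂ)) (q : Edge 3 L × Fin (fundamentalLatticeRep 2).N × Fin (fundamentalLatticeRep 2).N × Bool) => (fun z : ℂ => if q.2.2.2 then z.im else z.re) ((fundamentalRep (Fin 2) (V q.1) : Matrix (Fin 2) (Fin 2) ℂ) q.2.1 q.2.2.1)) V) (fun q : Edge 3 L × Fin (fundamentalLatticeRep 2).N × Fin (fundamentalLatticeRep 2).N × Bool => if n.1 = q.1 then (fun z : ℂ => if q.2.2.2 then z.im else z.re) (((Real.sqrt 2 : ℂ) • ((fundamentalLatticeRep 2).lieProj (noiseDir n.2) * (fun (ee : Edge 3 L) => Matrix.of fun (i j : Fin (fundamentalLatticeRep 2).N) => (((fun (V : GaugeConfig 3 L (Matrix.specialUnitaryGroup (Fin 2) ℂ)) (q : Edge 3 L × Fin (fundamentalLatticeRep 2).N × Fin (fundamentalLatticeRep 2).N × Bool) => (fun z : ℂ => if q.2.2.2 then z.im else z.re) ((fundamentalRep (Fin 2) (V q.1) : Matrix (Fin 2) (Fin 2) ℂ) q.2.1 q.2.2.1)) V (ee, i, j, false) : ℝ) : ℂ) + (((fun (V : GaugeConfig 3 L (Matrix.specialUnitaryGroup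 (Fin 2) ℂ)) (q : Edge 3 L × Fin (fundamentalLatticeRep 2).N × Fin (fundamentalLatticeRep 2).N × Bool) => (fun z : ℂ => if q.2.2.2 then z.im else z.re) ((fundamentalRep (Fin 2) (V q.1) : Matrix (Fin 2) (Fin 2) ℂ) q.2.1 q.2.2.1)) V (ee, i, j, true) : ℝ) : ℂ) * Complex.I) q.1)) q.2.1 q.2.2.1) else 0)
        ≤ K₀ * ∑ n : Edge 3 L × NoiseIdx (fundamentalLatticeRep 2).N, c n.1 * (Λ (fun q : Edge 3 L × Fin (fundamentalLatticeRep 2).N × Fin (fundamentalLatticeRep 2).N × Bool => if n.1 = q.1 then (fun z : ℂ => if q.2.2.2 then z.im else z.re) (((Real.sqrt 2 : ℂ) • ((fundamentalLatticeRep 2).lieProj (noiseDir n.2) * (fun (ee : Edge 3 L) => Matrix.of fun (i j : Fin (fundamentalLatticeRep 2).N) => (((fun (V : GaugeConfig 3 L (Matrix.specialUnitaryGroup (Fin 2) ℂ)) (q : Edge 3 L × Fin (fundamentalLatticeRep 2).N × Fin (fundamentalLatticeRep 2).N × Bool) => (fun z : ℂ => if q.2.2.2 then z.im else z.re) ((fundamentalRep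 (Fin 2) (V q.1) : Matrix (Fin 2) (Fin 2) ℂ) q.2.1 q.2.2.1)) V (ee, i, j, false) : ℝ) : ℂ) + (((fun (V : GaugeConfig 3 L (Matrix.specialUnitaryGroup (Fin 2) ℂ)) (q : Edge 3 L × Fin (fundamentalLatticeRep 2).N × Fin (fundamentalLatticeRep 2).N × Bool) => (fun z : ℂ => if q.2.2.2 then z.im else z.re) ((fundamentalRep (Fin 2) (V q.1) : Matrix (Fin 2) (Fin 2) ℂ) q.2.1 q.2.2.1)) V (ee, i, j, true) : ℝ) : ℂ) * Complex.I) q.1)) q.2.1 q.2.2.1) else 0)) ^ 2))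
    (κ : ℝ≥0 → Kernel (GaugeConfig 3 L (Matrix.specialUnitaryGroup (Fin 2) ℂ))
      (GaugeConfig 3 L (Matrix.specialUnitaryGroup (Fin 2) ℂ))) [∀ t, IsMarkovKernel (κ t)]
    (hreal : ∀ (t : ℝ≥0) (x : GaugeConfig 3 L (Matrix.specialUnitaryGroup (Fin 2) ℂ))
        (Ω : Type) [MeasurableSpace Ω] (P : Measure Ω) [IsProbabilityMeasure P]
        (W : ℝ≥0 → Ω → (Edge 3 L × NoiseIdx 2 → ℝ)) (hW : IsFlatBrownian W P)
        (U : ℝ≥0 → Ω → GaugeConfig 3 L (Matrix.specialUnitaryGroup (Fin 2) ℂ)),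
        (∀ ω, U 0 ω = x) →
        (latticeLangevinDynamics (fundamentalLatticeRep 2) β').IsSolution (fundamentalRep (Fin 2))
          hW.natFiltration P W U →
        κ t x = P.map (U t))
    {f : (Edge 3 L × Fin 2 × Fin 2 × Bool → ℝ) → ℝ} (hf : ContDiff ℝ 9 f) (hfc : HasCompactSupport f)
    {h : (Edge 3 L × Fin 2 × Fin 2 × Bool → ℝ) → ℝ} (hh : ContDiff ℝ 3 h) (hhc : HasCompactSupport h)
    (t : ℝ≥0) {g : (Edge 3 L × Fin 2 × Fin 2 × Bool → ℝ) → ℝ} (hg : ContDiff ℝ 1 g) :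
    let coords : GaugeConfig 3 L (Matrix.specialUnitaryGroup (Fin 2) ℂ) → (Edge 3 L × Fin 2 × Fin 2 × Bool → ℝ) :=
      fun V q => (fun z : ℂ => if q.2.2.2 then z.im else z.re)
        ((fundamentalRep (Fin 2) (V q.1) : Matrix (Fin 2) (Fin 2) ℂ) q.2.1 q.2.2.1)
    (∀ x, 0 ≤ h (coords x)) → (∀ x, ∫ y, f (coords y) ∂(κ t x) = g (coords x)) →
    Real.exp ((2 - K₀) * (t : ℝ)) * ∫ x, h (coords x) * (∑ n : Edge 3 L × NoiseIdx (fundamentalLatticeRep 2).N, c n.1 * (fderiv ℝ g (coords x) (fun q : Edge 3 L × Fin (fundamentalLatticeRep 2).N × Fin (fundamentalLatticeRep 2).N × Bool => if n.1 = q.1 then (fun z : ℂ => if q.2.2.2 then z.im else z.re) (((Real.sqrt 2 : ℂ) • ((fundamentalLatticeRep 2).lieProj (noiseDir n.2) * (fun (ee : Edge 3 L) => Matrix.of fun (i j : Fin (fundamentalLatticeRep 2).N) => ((coords x (ee, i, j, false) : ℝ) : ℂ) + ((coords x (ee, i, j, true) : ℝ) : ℂ) * Complex.I) q.1)) q.2.1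 q.2.2.1) else 0)) ^ 2) ∂(wilsonMeasure (d := 3) (L := L) (fundamentalRep (Fin 2)) β') ≤
      ∫ x, h (coords x) * (∫ y, (∑ n : Edge 3 L × NoiseIdx (fundamentalLatticeRep 2).N, c n.1 * (fderiv ℝ f (coords y) (fun q : Edge 3 L × Fin (fundamentalLatticeRep 2).N × Fin (fundamentalLatticeRep 2).N × Bool => if n.1 = q.1 then (fun z : ℂ => if q.2.2.2 then z.im else z.re) (((Real.sqrt 2 : ℂ) • ((fundamentalLatticeRep 2).lieProj (noiseDir n.2) * (fun (ee : Edge 3 L) => Matrix.of fun (i j : Fin (fundamentalLatticeRep 2).N) => ((coords y (ee, i, j, false) : ℝ) : ℂ) + ((coords y (ee, i, j, true) : ℝ) : ℂ) * Complex.I) q.1)) q.2.1 q.2.2.1) else 0)) ^ 2) ∂(κ t x)) ∂(wilsonMeasure (d := 3) (L := L) (fundamentalRep (Fin 2)) β') := by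
  intro coords hh0 hgrep
  classical
  set gen : ((Edge 3 L × Fin 2 × Fin 2 × Bool → ℝ) → ℝ) → GaugeConfig 3 L (Matrix.specialUnitaryGroup (Fin 2) ℂ) → ℝ :=
      fun h V =>
      (∑ i : Edge 3 L × Fin 2 × Fin 2 × Bool, fderiv ℝ h (coords V) (Pi.single i 1) *
          (fun z : ℂ => if i.2.2.2 then z.im else z.re)
            ((latticeLangevinDynamics (fundamentalLatticeRep 2) β').drift
              (matrixConfig (fundamentalRep (Fin 2)) V) i.1 i.2.1 i.2.2.1) +
      1 / 2 * ∑ i : Edge 3 L × Fin 2 × Fin 2 × Bool, ∑ j : Edge 3 L × Fin 2 × Fin 2 × Bool,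
        fderiv ℝ (fun z => fderiv ℝ h z (Pi.single i 1)) (coords V) (Pi.single j 1) *
          ∑ n : Edge 3 L × NoiseIdx 2,
            (if n.1 = i.1 then (fun z : ℂ => if i.2.2.2 then z.im else z.re)
              ((latticeLangevinDynamics (fundamentalLatticeRep 2) β').noise
                (matrixConfig (fundamentalRep (Fin 2)) V) i.1 n.2 i.2.1 i.2.2.1) else 0) *
            (if n.1 = j.1 then (fun z : ℂ => if j.2.2.2 then z.im else z.re)
              ((latticeLangevinDynamics (fundamentalLatticeRep 2) β').noise
                (matrixConfig (fundamentalRep (Fin 2)) V) j.1 n.2 j.2.1 j.2.2.1) else 0)) with hgen_def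
  haveI := secondCountableTopology_su2
  haveI := borelSpace_config L
  set μ : Measure (GaugeConfig 3 L (Matrix.specialUnitaryGroup (Fin 2) ℂ)) := (wilsonMeasure (d := 3) (L := L) (fundamentalRep (Fin 2)) β') with hμ
  haveI : IsProbabilityMeasure μ :=
    isProbabilityMeasure_wilsonMeasure (d := 3) (L := L) (fundamentalRep (Fin 2)) (continuous_fundamentalRep (Fin 2)) β'
  have hco : Continuous coords := continuous_coords (L := L)
  have hInt : ∀ {Φ : (GaugeConfig 3 L (Matrix.specialUnitaryGroup (Fin 2) ℂ)) → ℝ}, Continuous Φ → Integrable Φ μ := fun hΦ => integrable_of_continuous_of_compactSpace hΦ μ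
  have hκ0 : κ 0 = Kernel.id := transitionKernel_zero_eq_id (L := L) (β' := β') κ hreal
  obtain ⟨hf3, hf5, hf7⟩ : ContDiff ℝ 3 f ∧ ContDiff ℝ 5 f ∧ ContDiff ℝ 7 f :=
    ⟨hf.of_le (by norm_num), hf.of_le (by norm_num), hf.of_le (by norm_num)⟩
  have hh2 : ContDiff ℝ 2 h := hh.of_le (by norm_num)
  -- the noise frame, the plaquette potential, the frame form of the generator
  obtain ⟨s, cc, hs, -, -, -, hCas⟩ := exists_noiseFrame L
  have hs2 : ∀ (n : Edge 3 L × NoiseIdx (fundamentalLatticeRep 2).N) (y : (Edge 3 L × Fin 2 × Fin 2 × Bool → ℝ)), s n y = (fun q : Edge 3 L × Fin (fundamentalLatticeRep 2).N × Fin (fundamentalLatticeRep 2).N × Bool => if n.1 = q.1 then (fun z : ℂ => if q.2.2.2 then z.im else z.re) (((Real.sqrt 2 : ℂ) • ((fundamentalLatticeRep 2).lieProj (noiseDir n.2) * (fun (ee : Edge 3 L) => Matrix.of fun (i j : Fin (fundamentalLatticeRep 2).N) => ((y (ee, i, j, false) : ℝ) : ℂ) + ((y (ee, i, j, true) : ℝ)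 : ℂ) * Complex.I) q.1)) q.2.1 q.2.2.1) else 0) := fun n y => hs n y
  obtain ⟨ψ, hψ⟩ : ∃ ψ : (Edge 3 L × Fin 2 × Fin 2 × Bool → ℝ) → ℝ, ψ = (fun y : (Edge 3 L × Fin (fundamentalLatticeRep 2).N × Fin (fundamentalLatticeRep 2).N × Bool → ℝ) => β' * ∑ p : Plaquette 3 L, (rootedLoop (fun (ee : Edge 3 L) (i j : Fin (fundamentalLatticeRep 2).N) => ((y (ee, i, j, false) : ℝ) : ℂ) + ((y (ee, i, j, true) : ℝ) : ℂ) * Complex.I) (p.1, p.2.1.1) p.2.1.2 false).trace.re) := ⟨_, rfl⟩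
  have hψC : ∀ k : ℕ, ContDiff ℝ k ψ := fun k => by rw [hψ]; exact contDiff_psiHat (d := 3) (L := L) (N := (fundamentalLatticeRep 2).N) β'
  have hD : ∀ φ : (Edge 3 L × Fin 2 × Fin 2 × Bool → ℝ) → ℝ, ContDiff ℝ 2 φ → ∀ V : (GaugeConfig 3 L (Matrix.specialUnitaryGroup (Fin 2) ℂ)), gen φ V = 1 / 2 * ∑ n : Edge 3 L × NoiseIdx (fundamentalLatticeRep 2).N,
      (fderiv ℝ (fun w => fderiv ℝ φ w (s n w)) (coords V) (s n (coords V)) +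
        fderiv ℝ ψ (coords V) (s n (coords V)) * fderiv ℝ φ (coords V) (s n (coords V))) := by
    intro φ hφ V; rw [hψ]; exact generator_eq_half_frameGen L β' s hs hCas φ hφ V
  -- §0 compactly supported representatives `a ∈ C⁷` of `𝓛f` and `a₂ ∈ C⁵` of `𝓛a`
  have hrep : ∀ (k : ℕ) {φ : (Edge 3 L × Fin 2 × Fin 2 × Bool → ℝ) → ℝ}, ContDiff ℝ (k + 2) φ → ∃ a : (Edge 3 L × Fin 2 × Fin 2 × Bool → ℝ) → ℝ, ContDiff ℝ k a ∧ HasCompactSupport a ∧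
      ∀ x : (GaugeConfig 3 L (Matrix.specialUnitaryGroup (Fin 2) ℂ)), a (coords x) = gen φ x := by
    intro k φ hφ
    set a₀ : (Edge 3 L × Fin 2 × Fin 2 × Bool → ℝ) → ℝ := fun z => 1 / 2 * ∑ n : Edge 3 L × NoiseIdx (fundamentalLatticeRep 2).N,
      (fderiv ℝ (fun w => fderiv ℝ φ w (s n w)) z (s n z) + fderiv ℝ ψ z (s n z) * fderiv ℝ φ z (s n z)) with ha₀
    have ha₀C : ContDiff ℝ k a₀ := contDiff_const.mul (contDiff_frameGen (k := k) hφ (hψC (k + 1)) s)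
    obtain ⟨a, ha, hac, hanear⟩ := exists_contDiff_hasCompactSupport_eqOn (n := k) ha₀C 1
    refine ⟨a, ha, hac, fun x => ?_⟩
    have h1 : a (coords x) = a₀ (coords x) := (hanear _ (norm_coords_le_one x)).self_of_nhds
    rw [h1, hD φ (hφ.of_le (by exact_mod_cast Nat.le_add_left 2 k)) x]
  obtain ⟨a, ha7, hac, haf⟩ := hrep 7 hf
  obtain ⟨a₂, ha₂5, ha₂c, haa⟩ := hrep 5 ha7
  obtain ⟨ha3, ha5⟩ : ContDiff ℝ 3 a ∧ ContDiff ℝ 5 a := ⟨ha7.of_le (by norm_num), ha7.of_le (by norm_num)⟩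
  have ha₂3 : ContDiff ℝ 3 a₂ := ha₂5.of_le (by norm_num)
  -- §1 Dynkin-class representatives of `κ_s F`, `κ_s(a∘coords)`, `κ_s(a₂∘coords)`, `κ_s H`
  have hBKf := fun σ : ℝ≥0 => transitionKernel_backwardKolmogorov (L := L) β' κ hreal hf3 hfc σ
  have hBKa := fun σ : ℝ≥0 => transitionKernel_backwardKolmogorov (L := L) β' κ hreal ha3 hac σ
  have hBKa₂ := fun σ : ℝ≥0 => transitionKernel_backwardKolmogorov (L := L) β' κ hreal ha₂3 ha₂c σ
  have hBKh := fun σ : ℝ≥0 => transitionKernel_backwardKolmogorov (L := L) β' κ hreal hh hhc σ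
  choose gF hgF hgFc hgFrep hgFcomm _ using hBKf
  choose gA hgA hgAc hgArep hgAcomm _ using hBKa
  choose gA₂ hgA₂ _ hgA₂rep _ _ using hBKa₂
  choose gH hgH hgHc hgHrep hgHcomm _ using hBKh
  have hgFrep' : ∀ (σ : ℝ≥0) (x : (GaugeConfig 3 L (Matrix.specialUnitaryGroup (Fin 2) ℂ))), ∫ y, f (coords y) ∂(κ σ x) = gF σ (coords x) := fun σ x => hgFrep σ x
  have hgArep' : ∀ (σ : ℝ≥0) (x : (GaugeConfig 3 L (Matrix.specialUnitaryGroup (Fin 2) ℂ))), ∫ y, a (coords y) ∂(κ σ x) = gA σ (coords x) := fun σ x => hgArep σ x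
  have hgA₂rep' : ∀ (σ : ℝ≥0) (x : (GaugeConfig 3 L (Matrix.specialUnitaryGroup (Fin 2) ℂ))), ∫ y, a₂ (coords y) ∂(κ σ x) = gA₂ σ (coords x) := fun σ x => hgA₂rep σ x
  have hgHrep' : ∀ (σ : ℝ≥0) (x : (GaugeConfig 3 L (Matrix.specialUnitaryGroup (Fin 2) ℂ))), ∫ y, h (coords y) ∂(κ σ x) = gH σ (coords x) := fun σ x => hgHrep σ x
  have hgFcomm' : ∀ (σ : ℝ≥0) (x : (GaugeConfig 3 L (Matrix.specialUnitaryGroup (Fin 2) ℂ))), gen (gF σ) x = ∫ y, gen f y ∂(κ σ x) := fun σ x => hgFcomm σ x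
  have hgHcomm' : ∀ (σ : ℝ≥0) (x : (GaugeConfig 3 L (Matrix.specialUnitaryGroup (Fin 2) ℂ))), gen (gH σ) x = ∫ y, gen h y ∂(κ σ x) := fun σ x => hgHcomm σ x
  have hgF1 : ∀ σ, ContDiff ℝ 1 (gF σ) := fun σ => (hgF σ).of_le (by norm_num)
  have hgA1 : ∀ σ, ContDiff ℝ 1 (gA σ) := fun σ => (hgA σ).of_le (by norm_num)
  have hgA₂1 : ∀ σ, ContDiff ℝ 1 (gA₂ σ) := fun σ => (hgA₂ σ).of_le (by norm_num)
  -- `gA s₂ ∘ coords = 𝓛(gF s₂)` on the group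
  have eAA : ∀ (σ : ℝ≥0) (x : (GaugeConfig 3 L (Matrix.specialUnitaryGroup (Fin 2) ℂ))), gA σ (coords x) = gen (gF σ) x := fun σ x => by
    rw [← hgArep' σ x, hgFcomm' σ x]
    exact integral_congr_ae (ae_of_all _ fun y => haf y)
  -- §2 the frame derivatives `w n τ x = W_n(gF_τ)(coords x)`, `wd n τ x = W_n(gA_τ)(coords x)` and their time-regularity
  obtain ⟨w, hw⟩ : ∃ w : (Edge 3 L × NoiseIdx (fundamentalLatticeRep 2).N) → ℝ → (GaugeConfig 3 L (Matrix.specialUnitaryGroup (Fin 2) ℂ)) → ℝ, w = fun n τ x => fderiv ℝ (gF τ.toNNReal) (coords x) (s n (coords x)) := ⟨_, rfl⟩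
  obtain ⟨wd, hwd⟩ : ∃ wd : (Edge 3 L × NoiseIdx (fundamentalLatticeRep 2).N) → ℝ → (GaugeConfig 3 L (Matrix.specialUnitaryGroup (Fin 2) ℂ)) → ℝ, wd = fun n τ x => fderiv ℝ (gA τ.toNNReal) (coords x) (s n (coords x)) := ⟨_, rfl⟩
  have cxw : ∀ n τ, Continuous fun x => w n τ x := fun n τ => by
    rw [hw]; exact (continuous_frameDeriv (hgF1 _) (s n)).comp hco
  have cxwd : ∀ n τ, Continuous fun x => wd n τ x := fun n τ => by
    rw [hwd]; exact (continuous_frameDeriv (hgA1 _) (s n)).comp hco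
  have hreg : ∀ (n : Edge 3 L × NoiseIdx (fundamentalLatticeRep 2).N) (x : (GaugeConfig 3 L (Matrix.specialUnitaryGroup (Fin 2) ℂ))), (Continuous fun τ : ℝ => w n τ x) ∧
      ∀ τ : ℝ, 0 < τ → HasDerivAt (fun τ : ℝ => w n τ x) (wd n τ x) τ := by
    intro n x
    have h := hasDerivAt_frameDeriv_transitionRep L β' κ hreal hf3 hfc ha5 hac ha₂5 gF gA gA₂ hgF1 hgA1 hgA₂1 n x haf haa hgFrep' hgArep' hgA₂rep'
    have e1 : (fun τ : ℝ => w n τ x) = fun τ : ℝ => fderiv ℝ (gF τ.toNNReal) (coords x) (fun q : Edge 3 L × Fin (fundamentalLatticeRep 2).N × Fin (fundamentalLatticeRep 2).N × Bool => if n.1 = q.1 then (fun z : ℂ => if q.2.2.2 then z.im else z.re) (((Real.sqrt 2 : ℂ) • ((fundamentalLatticeRep 2).lieProj (noiseDir n.2) * (fun (ee : Edge 3 L) => Matrix.of fun (i j : Fin (fundamentalLatticeRep 2).N) => ((coords x (ee, i, j, false) : ℝ) : ℂ) + ((coords x (ee, i, j, true) : ℝ) : ℂ) * Complex.I) q.1))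 q.2.1 q.2.2.1) else 0) := by
      rw [hw]; funext τ; dsimp only; rw [hs2 n (coords x)]
    have e2 : ∀ τ : ℝ, wd n τ x = fderiv ℝ (gA τ.toNNReal) (coords x) (fun q : Edge 3 L × Fin (fundamentalLatticeRep 2).N × Fin (fundamentalLatticeRep 2).N × Bool => if n.1 = q.1 then (fun z : ℂ => if q.2.2.2 then z.im else z.re) (((Real.sqrt 2 : ℂ) • ((fundamentalLatticeRep 2).lieProj (noiseDir n.2) * (fun (ee : Edge 3 L) => Matrix.of fun (i j : Fin (fundamentalLatticeRep 2).N) => ((coords x (ee, i, j, false) : ℝ) : ℂ) + ((coords x (ee, i, j, true) : ℝ) : ℂ) * Complex.I) q.1)) q.2.1 q.2.2.1) else 0) := by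
      intro τ; rw [hwd]; dsimp only; rw [hs2 n (coords x)]
    rw [e1]
    refine ⟨h.1, fun τ hτ => ?_⟩
    rw [e2 τ]
    exact h.2 τ hτ
  have ctwd : ∀ (n : Edge 3 L × NoiseIdx (fundamentalLatticeRep 2).N) (x : (GaugeConfig 3 L (Matrix.specialUnitaryGroup (Fin 2) ℂ))), Continuous fun τ : ℝ => wd n τ x := by
    intro n x
    have h := continuous_frameDeriv_transitionRep L β' κ hreal ha3 hac ha₂5 gA gA₂ hgA1 hgA₂1 n x haa hgArep' hgA₂rep'
    have e1 : (fun τ : ℝ => wd n τ x) = fun τ : ℝ => fderiv ℝ (gA τ.toNNReal) (coords x) (fun q : Edge 3 L × Fin (fundamentalLatticeRep 2).N × Fin (fundamentalLatticeRep 2).N × Bool => if n.1 = q.1 then (fun z : ℂ => if q.2.2.2 then z.im else z.re) (((Real.sqrt 2 : ℂ) • ((fundamentalLatticeRep 2).lieProj (noiseDir n.2) * (fun (ee : Edge 3 L) => Matrix.of fun (i j : Fin (fundamentalLatticeRep 2).N) => ((coords x (ee, i, j, false) : ℝ) : ℂ) + ((coords x (ee, i, j, true) : ℝ) : ℂ)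 * Complex.I) q.1)) q.2.1 q.2.2.1) else 0) := by
      rw [hwd]; funext τ; dsimp only; rw [hs2 n (coords x)]
    rw [e1]; exact h
  -- uniform bounds on `[0, T]`
  set T : ℝ := (t : ℝ) with hT
  have hT0 : 0 ≤ T := t.coe_nonneg
  obtain ⟨M₁, hM₁0, hM₁⟩ := abs_frameDeriv_transitionRep_le L β' κ hreal hf5 T
  obtain ⟨M₂, hM₂0, hM₂⟩ := abs_frameDeriv_transitionRep_le L β' κ hreal ha5 T
  have htoNN : ∀ r : ℝ, r ≤ T → ((r.toNNReal : ℝ≥0) : ℝ) ≤ T := fun r hr => by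
    rw [Real.coe_toNNReal']; exact max_le hr hT0
  have bw : ∀ n (r : ℝ), r ≤ T → ∀ x, |w n r x| ≤ M₁ := by
    intro n r hr x
    have h := hM₁ r.toNNReal (htoNN r hr) (gF r.toNNReal) (hgF1 _) (fun y => hgFrep' _ y) n x
    rw [hw]; dsimp only; rw [hs2 n (coords x)]; exact h
  have bwd : ∀ n (r : ℝ), r ≤ T → ∀ x, |wd n r x| ≤ M₂ := by
    intro n r hr x
    have h := hM₂ r.toNNReal (htoNN r hr) (gA r.toNNReal) (hgA1 _) (fun y => hgArep' _ y) n x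
    rw [hwd]; dsimp only; rw [hs2 n (coords x)]; exact h
  -- §3 the kernel actions `κ_σ H`, `κ_σ(𝓛H)`
  have cH : Continuous fun y : (GaugeConfig 3 L (Matrix.specialUnitaryGroup (Fin 2) ℂ)) => h (coords y) := hh.continuous.comp hco
  have cB : Continuous (gen h) := continuous_generator (L := L) β' hh2
  obtain ⟨PH, hPH⟩ : ∃ PH : ℝ → (GaugeConfig 3 L (Matrix.specialUnitaryGroup (Fin 2) ℂ)) → ℝ, PH = fun τ x => ∫ y, h (coords y) ∂(κ τ.toNNReal x) := ⟨_, rfl⟩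
  obtain ⟨PB, hPB⟩ : ∃ PB : ℝ → (GaugeConfig 3 L (Matrix.specialUnitaryGroup (Fin 2) ℂ)) → ℝ, PB = fun τ x => ∫ y, gen h y ∂(κ τ.toNNReal x) := ⟨_, rfl⟩
  have hcx : ∀ {Φ : (GaugeConfig 3 L (Matrix.specialUnitaryGroup (Fin 2) ℂ)) → ℝ}, Continuous Φ → ∀ τ : ℝ, Continuous fun x => ∫ y, Φ y ∂(κ τ.toNNReal x) :=
    fun hΦ τ => continuous_integral_transitionKernel L β' κ hreal τ.toNNReal hΦ
  have hct : ∀ {Φ : (GaugeConfig 3 L (Matrix.specialUnitaryGroup (Fin 2) ℂ)) → ℝ}, Continuous Φ → ∀ x : (GaugeConfig 3 L (Matrix.specialUnitaryGroup (Fin 2) ℂ)), Continuous fun τ : ℝ => ∫ y, Φ y ∂(κ τ.toNNReal x) :=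
    fun hΦ x => (continuous_transitionKernel_action (L := L) β' κ hreal hΦ).comp (continuous_real_toNNReal.prodMk continuous_const)
  have hbd : ∀ {Φ : (GaugeConfig 3 L (Matrix.specialUnitaryGroup (Fin 2) ℂ)) → ℝ}, Continuous Φ → ∃ M : ℝ, ∀ (τ : ℝ) (x : (GaugeConfig 3 L (Matrix.specialUnitaryGroup (Fin 2) ℂ))), |∫ y, Φ y ∂(κ τ.toNNReal x)| ≤ M := by
    intro Φ hΦ
    obtain ⟨M, hM⟩ : ∃ M, ∀ y : (GaugeConfig 3 L (Matrix.specialUnitaryGroup (Fin 2) ℂ)), |Φ y| ≤ M := by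
      obtain ⟨M, hM⟩ := isCompact_univ.exists_bound_of_continuousOn hΦ.continuousOn
      exact ⟨M, fun y => by simpa [Real.norm_eq_abs] using hM y (Set.mem_univ y)⟩
    refine ⟨M, fun τ x => ?_⟩
    haveI : IsProbabilityMeasure (κ τ.toNNReal x) := IsMarkovKernel.isProbabilityMeasure x
    refine (abs_integral_le_integral_abs).trans ?_
    calc ∫ y, |Φ y| ∂(κ τ.toNNReal x) ≤ ∫ _y, M ∂(κ τ.toNNReal x) :=
          integral_mono (integrable_of_continuous_of_compactSpace (continuous_abs.comp hΦ) _) (integrable_const _) fun y => hM y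
      _ = M := by simp
  have h0 : ∀ {Φ : (GaugeConfig 3 L (Matrix.specialUnitaryGroup (Fin 2) ℂ)) → ℝ}, Continuous Φ → ∀ x : (GaugeConfig 3 L (Matrix.specialUnitaryGroup (Fin 2) ℂ)), ∫ y, Φ y ∂(κ (0 : ℝ).toNNReal x) = Φ x := by
    intro Φ hΦ x
    rw [Real.toNNReal_zero, hκ0, Kernel.id_apply, integral_dirac' _ _ hΦ.measurable.stronglyMeasurable]
  obtain ⟨⟨MH, hMH⟩, ⟨MB, hMB⟩⟩ := And.intro (hbd cH) (hbd cB)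
  have bH : ∀ τ x, |PH τ x| ≤ MH := fun τ x => by rw [hPH]; exact hMH τ x
  have bB : ∀ τ x, |PB τ x| ≤ MB := fun τ x => by rw [hPB]; exact hMB τ x
  have cxH : ∀ τ, Continuous fun x => PH τ x := fun τ => by rw [hPH]; exact hcx cH τ
  have cxB : ∀ τ, Continuous fun x => PB τ x := fun τ => by rw [hPB]; exact hcx cB τ
  have ctH : ∀ x, Continuous fun τ => PH τ x := fun x => by rw [hPH]; exact hct cH x
  have ctB : ∀ x, Continuous fun τ => PB τ x := fun x => by rw [hPB]; exact hct cB x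
  have dH : ∀ x {τ : ℝ}, 0 < τ → HasDerivAt (fun τ => PH τ x) (PB τ x) τ := by
    intro x τ hτ
    have hDf := fun {σ : ℝ} (hσ : (0 : ℝ) ≤ σ) => transitionKernel_dynkin (L := L) β' κ hreal hh hhc x hσ
    have hac' : Continuous fun r : ℝ => ∫ y, gen h y ∂(κ r.toNNReal x) := hct cB x
    have hder : HasDerivAt (fun σ : ℝ => h (coords x) + ∫ r in (0 : ℝ)..σ, ∫ y, gen h y ∂(κ r.toNNReal x))
        (∫ y, gen h y ∂(κ τ.toNNReal x)) τ :=
      ((intervalIntegral.integral_hasDerivAt_right (hac'.intervalIntegrable _ _)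
        (hac'.stronglyMeasurableAtFilter _ _) hac'.continuousAt)).const_add _
    rw [hPH, hPB]
    refine hder.congr_of_eventuallyEq ?_
    filter_upwards [Ioi_mem_nhds hτ] with σ hσ
    exact hDf (le_of_lt hσ)
  -- §4 the flow functional `Λ(σ) = ∫ κ_σH · Γ^c(κ_(T−σ)F) dμ` and its derivative
  have MΦ : ∀ (r : ℝ), r ≤ T → ∀ x, |∑ n : Edge 3 L × NoiseIdx (fundamentalLatticeRep 2).N, c n.1 * (w n r x * w n r x)| ≤ ∑ n : Edge 3 L × NoiseIdx (fundamentalLatticeRep 2).N, c n.1 * (M₁ * M₁) := by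
    intro r hr x
    refine (Finset.abs_sum_le_sum_abs _ _).trans (Finset.sum_le_sum fun n _ => ?_)
    rw [abs_mul, abs_of_nonneg (hc0 n.1)]
    exact mul_le_mul_of_nonneg_left (by rw [abs_mul]; exact mul_le_mul (bw n r hr x) (bw n r hr x) (abs_nonneg _) hM₁0) (hc0 n.1)
  have MΦd : ∀ (r : ℝ), r ≤ T → ∀ x, |∑ n : Edge 3 L × NoiseIdx (fundamentalLatticeRep 2).N, c n.1 * (-(wd n r x) * w n r x + w n r x * -(wd n r x))| ≤ ∑ n : Edge 3 L × NoiseIdx (fundamentalLatticeRep 2).N, c n.1 * (2 * (M₂ * M₁)) := by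
    intro r hr x
    refine (Finset.abs_sum_le_sum_abs _ _).trans (Finset.sum_le_sum fun n _ => ?_)
    rw [abs_mul, abs_of_nonneg (hc0 n.1)]
    refine mul_le_mul_of_nonneg_left ?_ (hc0 n.1)
    have e : -(wd n r x) * w n r x + w n r x * -(wd n r x) = -(2 * (wd n r x * w n r x)) := by ring
    rw [e, abs_neg, abs_mul, abs_mul, show |(2 : ℝ)| = 2 by norm_num]
    exact mul_le_mul_of_nonneg_left (mul_le_mul (bwd n r hr x) (bw n r hr x) (abs_nonneg _) hM₂0) (by norm_num)
  obtain ⟨Λ, hΛ⟩ : ∃ Λ : ℝ → ℝ, Λ = fun σ => ∫ x, PH σ x * ∑ n : Edge 3 L × NoiseIdx (fundamentalLatticeRep 2).N, c n.1 * (w n (T - σ) x * w n (T - σ) x) ∂μ := ⟨_, rfl⟩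
  obtain ⟨Λd, hΛd⟩ : ∃ Λd : ℝ → ℝ, Λd = fun σ => ∫ x, (PB σ x * ∑ n : Edge 3 L × NoiseIdx (fundamentalLatticeRep 2).N, c n.1 * (w n (T - σ) x * w n (T - σ) x) +
      PH σ x * ∑ n : Edge 3 L × NoiseIdx (fundamentalLatticeRep 2).N, c n.1 * (-(wd n (T - σ) x) * w n (T - σ) x + w n (T - σ) x * -(wd n (T - σ) x))) ∂μ := ⟨_, rfl⟩
  have cxΦ : ∀ r : ℝ, Continuous fun x => ∑ n : Edge 3 L × NoiseIdx (fundamentalLatticeRep 2).N, c n.1 * (w n r x * w n r x) := fun r =>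
    continuous_finsetSum _ fun n _ => continuous_const.mul ((cxw n r).mul (cxw n r))
  have cxΦd : ∀ r : ℝ, Continuous fun x => ∑ n : Edge 3 L × NoiseIdx (fundamentalLatticeRep 2).N, c n.1 * (-(wd n r x) * w n r x + w n r x * -(wd n r x)) := fun r =>
    continuous_finsetSum _ fun n _ => continuous_const.mul (((cxwd n r).neg.mul (cxw n r)).add ((cxw n r).mul (cxwd n r).neg))
  have hΛc : ContinuousOn Λ (Icc 0 T) := by
    rw [hΛ]
    refine continuousOn_of_dominated (bound := fun _ => MH * ∑ n : Edge 3 L × NoiseIdx (fundamentalLatticeRep 2).N, c n.1 * (M₁ * M₁)) (fun σ _ => ?_) (fun σ hσ => ?_)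
      (integrable_const _) (ae_of_all _ fun x => ?_)
    · exact ((cxH σ).mul (cxΦ _)).aestronglyMeasurable
    · refine ae_of_all _ fun x => ?_
      rw [Real.norm_eq_abs, abs_mul]
      exact mul_le_mul (bH σ x) (MΦ (T - σ) (by linarith [hσ.1]) x) (abs_nonneg _) ((abs_nonneg _).trans (bH σ x))
    · have cs : Continuous fun σ : ℝ => T - σ := continuous_const.sub continuous_id
      exact ((ctH x).mul (continuous_finsetSum _ fun n _ => continuous_const.mul
        ((((hreg n x).1.comp cs)).mul ((hreg n x).1.comp cs)))).continuousOn
  have hΛder : ∀ σ ∈ Ioo 0 T, HasDerivAt Λ (Λd σ) σ := by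
    intro σ hσ
    obtain ⟨hσ0, hσT⟩ := hσ
    rw [hΛ, hΛd]
    have hsI : Ioo (σ / 2) ((σ + T) / 2) ∈ 𝓝 σ := Ioo_mem_nhds (by linarith) (by linarith)
    refine (hasDerivAt_integral_of_dominated_loc_of_deriv_le (μ := μ) (x₀ := σ)
      (F := fun σ x => PH σ x * ∑ n : Edge 3 L × NoiseIdx (fundamentalLatticeRep 2).N, c n.1 * (w n (T - σ) x * w n (T - σ) x))
      (F' := fun σ x => PB σ x * ∑ n : Edge 3 L × NoiseIdx (fundamentalLatticeRep 2).N, c n.1 * (w n (T - σ) x * w n (T - σ) x) +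
        PH σ x * ∑ n : Edge 3 L × NoiseIdx (fundamentalLatticeRep 2).N, c n.1 * (-(wd n (T - σ) x) * w n (T - σ) x + w n (T - σ) x * -(wd n (T - σ) x)))
      (bound := fun _ => MB * ∑ n : Edge 3 L × NoiseIdx (fundamentalLatticeRep 2).N, c n.1 * (M₁ * M₁) + MH * ∑ n : Edge 3 L × NoiseIdx (fundamentalLatticeRep 2).N, c n.1 * (2 * (M₂ * M₁))) hsI ?_ ?_ ?_ ?_ (integrable_const _) ?_).2
    · exact Filter.Eventually.of_forall fun σ' => ((cxH σ').mul (cxΦ _)).aestronglyMeasurable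
    · exact hInt ((cxH σ).mul (cxΦ _))
    · exact (((cxB σ).mul (cxΦ _)).add ((cxH σ).mul (cxΦd _))).aestronglyMeasurable
    · refine ae_of_all _ fun x σ' hσ' => ?_
      obtain ⟨hσ'1, hσ'2⟩ := hσ'
      have hTσ' : T - σ' ≤ T := by linarith
      rw [Real.norm_eq_abs]
      refine (abs_add_le _ _).trans (add_le_add ?_ ?_)
      · rw [abs_mul]; exact mul_le_mul (bB σ' x) (MΦ (T - σ') hTσ' x) (abs_nonneg _) ((abs_nonneg _).trans (bB σ' x))
      · rw [abs_mul]; exact mul_le_mul (bH σ' x) (MΦd (T - σ') hTσ' x) (abs_nonneg _) ((abs_nonneg _).trans (bH σ' x))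
    · refine ae_of_all _ fun x σ' hσ' => ?_
      obtain ⟨hσ'1, hσ'2⟩ := hσ'
      have hσ'0 : 0 < σ' := by linarith
      have hTσ' : 0 < T - σ' := by linarith
      have eH := dH x hσ'0
      have ew : ∀ n : Edge 3 L × NoiseIdx (fundamentalLatticeRep 2).N, HasDerivAt (fun σ => w n (T - σ) x) (-(wd n (T - σ') x)) σ' := by
        intro n
        have hc := HasDerivAt.comp σ' ((hreg n x).2 (T - σ') hTσ') ((hasDerivAt_id σ').const_sub T)
        exact hc.congr_deriv (by ring)
      have eΦ : HasDerivAt (fun σ => ∑ n : Edge 3 L × NoiseIdx (fundamentalLatticeRep 2).N, c n.1 * (w n (T - σ) x * w n (T - σ) x))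
          (∑ n : Edge 3 L × NoiseIdx (fundamentalLatticeRep 2).N, c n.1 * (-(wd n (T - σ') x) * w n (T - σ') x + w n (T - σ') x * -(wd n (T - σ') x))) σ' :=
        HasDerivAt.fun_sum fun n _ => ((ew n).mul (ew n)).const_mul (c n.1)
      exact eH.mul eΦ
  -- §5 the key inequality `Λd ≥ (2 − K₀)·Λ` on `(0, T)`
  have hkey : ∀ σ ∈ Ioo 0 T, (2 - K₀) * Λ σ ≤ Λd σ := by
    intro σ hσ
    obtain ⟨hσ0, hσT⟩ := hσ
    set s₁ : ℝ≥0 := σ.toNNReal with hs₁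
    set s₂ : ℝ≥0 := (T - σ).toNNReal with hs₂
    have eH : ∀ x, PH σ x = gH s₁ (coords x) := fun x => by rw [hPH]; exact hgHrep' s₁ x
    have eB : ∀ x, PB σ x = gen (gH s₁) x := fun x => by rw [hPB, hgHcomm' s₁ x]
    have ew : ∀ n x, w n (T - σ) x = fderiv ℝ (gF s₂) (coords x) (s n (coords x)) := fun n x => by rw [hw]
    have ewd : ∀ n x, wd n (T - σ) x = fderiv ℝ (gA s₂) (coords x) (s n (coords x)) := fun n x => by rw [hwd]
    have hG0 : ∀ x, 0 ≤ gH s₁ (coords x) := fun x => by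
      rw [← hgHrep' s₁ x]; exact integral_nonneg fun y => hh0 y
    -- the pointwise weighted curvature inequality for `u = gF s₂`, `v = gA s₂`
    have hcurv := generator_wcarre_sub_ge_of_whessBound L β' K₀ c hc0 hHess (hgF s₂) ((hgA s₂).of_le (by norm_num)) (fun V => eAA s₂ V)
    -- the ambient weighted carré `Φ̃` of `gF s₂` and the symmetry of `𝓛`
    obtain ⟨Gu, hGu⟩ : ∃ Gu : (Edge 3 L × Fin 2 × Fin 2 × Bool → ℝ) → ℝ, Gu = fun z => ∑ n : Edge 3 L × NoiseIdx (fundamentalLatticeRep 2).N, c n.1 * (fderiv ℝ (gF s₂) z (s n z)) ^ 2 := ⟨_, rfl⟩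
    have hGu_eq : (fun y : (Edge 3 L × Fin 2 × Fin 2 × Bool → ℝ) => ∑ n : Edge 3 L × NoiseIdx (fundamentalLatticeRep 2).N, c n.1 * (fderiv ℝ (gF s₂) y (fun q : Edge 3 L × Fin (fundamentalLatticeRep 2).N × Fin (fundamentalLatticeRep 2).N × Bool => if n.1 = q.1 then (fun z : ℂ => if q.2.2.2 then z.im else z.re) (((Real.sqrt 2 : ℂ) • ((fundamentalLatticeRep 2).lieProj (noiseDir n.2) * (fun (ee : Edge 3 L) => Matrix.of fun (i j : Fin (fundamentalLatticeRep 2).N) => ((y (ee, i, j, false) : ℝ) : ℂ) + ((y (ee, i, j, true) : ℝ) : ℂ) * Complex.I) q.1)) q.2.1 q.2.2.1) else 0)) ^ 2) = Gu := by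
      rw [hGu]; funext z
      exact Finset.sum_congr rfl fun n _ => by rw [hs2 n z]
    have hGuC : ContDiff ℝ 2 Gu := by
      rw [hGu]; exact ContDiff.sum fun n _ => contDiff_const.mul ((contDiff_frameDeriv (k := 2) (hgF s₂) (s n)).pow 2)
    have hsymm : ∫ x, gH s₁ (coords x) * gen Gu x ∂μ = ∫ x, Gu (coords x) * gen (gH s₁) x ∂μ :=
      integral_mul_generator_symm_of_contDiff_two L β' hGuC ((hgH s₁).of_le (by norm_num))
    -- pointwise: `(2 − K₀) Φ ≤ gen Gu − 2 Σ c W_nu W_nv`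
    have hpt : ∀ x, (2 - K₀) * ∑ n : Edge 3 L × NoiseIdx (fundamentalLatticeRep 2).N, c n.1 * (w n (T - σ) x * w n (T - σ) x) ≤
        gen Gu x - 2 * ∑ n : Edge 3 L × NoiseIdx (fundamentalLatticeRep 2).N, c n.1 * (w n (T - σ) x * wd n (T - σ) x) := by
      intro x
      have h := hcurv x
      rw [hGu_eq] at h
      have e1 : ∑ n : Edge 3 L × NoiseIdx (fundamentalLatticeRep 2).N, c n.1 * (fderiv ℝ (gF s₂) (coords x) (fun q : Edge 3 L × Fin (fundamentalLatticeRep 2).N × Fin (fundamentalLatticeRep 2).N × Bool => if n.1 = q.1 then (fun z : ℂ => if q.2.2.2 then z.im else z.re) (((Real.sqrt 2 : ℂ) • ((fundamentalLatticeRep 2).lieProj (noiseDir n.2) * (fun (ee : Edge 3 L) => Matrix.of fun (i j : Fin (fundamentalLatticeRep 2).N) => ((coords x (ee, i, j, false) : ℝ) : ℂ) + ((coords x (ee, i, j, true) : ℝ) : ℂ) * Complex.I) q.1)) q.2.1 q.2.2.1) else 0)) ^ 2 = ∑ n : Edge 3 L × NoiseIdx (fundamentalLatticeRep 2).N, c n.1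 * (w n (T - σ) x * w n (T - σ) x) :=
        Finset.sum_congr rfl fun n _ => by rw [ew n x, hs2 n (coords x), sq]
      have e2 : ∑ n : Edge 3 L × NoiseIdx (fundamentalLatticeRep 2).N, c n.1 * fderiv ℝ (gF s₂) (coords x) (fun q : Edge 3 L × Fin (fundamentalLatticeRep 2).N × Fin (fundamentalLatticeRep 2).N × Bool => if n.1 = q.1 then (fun z : ℂ => if q.2.2.2 then z.im else z.re) (((Real.sqrt 2 : ℂ) • ((fundamentalLatticeRep 2).lieProj (noiseDir n.2) * (fun (ee : Edge 3 L) => Matrix.of fun (i j : Fin (fundamentalLatticeRep 2).N) => ((coords x (ee, i, j, false) : ℝ) : ℂ) + ((coords x (ee, i, j, true) : ℝ) : ℂ) * Complex.I) q.1)) q.2.1 q.2.2.1) else 0) * fderiv ℝ (gA s₂) (coords x) (fun q : Edge 3 L × Fin (fundamentalLatticeRep 2).N × Fin (fundamentalLatticeRep 2).N × Bool => if n.1 = q.1 then (fun z : ℂ => if q.2.2.2 then z.im else z.re) (((Real.sqrt 2 : ℂ) • ((fundamentalLatticeRep 2).lieProj (noiseDir n.2) * (fun (ee : Edge 3 L)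 => Matrix.of fun (i j : Fin (fundamentalLatticeRep 2).N) => ((coords x (ee, i, j, false) : ℝ) : ℂ) + ((coords x (ee, i, j, true) : ℝ) : ℂ) * Complex.I) q.1)) q.2.1 q.2.2.1) else 0) =
          ∑ n : Edge 3 L × NoiseIdx (fundamentalLatticeRep 2).N, c n.1 * (w n (T - σ) x * wd n (T - σ) x) :=
        Finset.sum_congr rfl fun n _ => by rw [ew n x, ewd n x, hs2 n (coords x), mul_assoc]
      rw [e1, e2] at h
      exact h
    -- integrate against `gH s₁ ∘ coords ≥ 0`
    have cG : Continuous fun x : (GaugeConfig 3 L (Matrix.specialUnitaryGroup (Fin 2) ℂ)) => gH s₁ (coords x) := (hgH s₁).continuous.comp hco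
    have cGu : Continuous fun x : (GaugeConfig 3 L (Matrix.specialUnitaryGroup (Fin 2) ℂ)) => Gu (coords x) := hGuC.continuous.comp hco
    have cgenGu : Continuous (gen Gu) := continuous_generator (L := L) β' hGuC
    have cgenH : Continuous (gen (gH s₁)) := continuous_generator (L := L) β' ((hgH s₁).of_le (by norm_num))
    have eΦGu : ∀ x, ∑ n : Edge 3 L × NoiseIdx (fundamentalLatticeRep 2).N, c n.1 * (w n (T - σ) x * w n (T - σ) x) = Gu (coords x) := fun x => by
      rw [hGu]; exact Finset.sum_congr rfl fun n _ => by rw [ew n x, sq]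
    have eΦd : ∀ x, ∑ n : Edge 3 L × NoiseIdx (fundamentalLatticeRep 2).N, c n.1 * (-(wd n (T - σ) x) * w n (T - σ) x + w n (T - σ) x * -(wd n (T - σ) x)) =
        -2 * ∑ n : Edge 3 L × NoiseIdx (fundamentalLatticeRep 2).N, c n.1 * (w n (T - σ) x * wd n (T - σ) x) := fun x => by
      rw [Finset.mul_sum]; exact Finset.sum_congr rfl fun n _ => by ring
    have hΛσ : Λ σ = ∫ x, gH s₁ (coords x) * Gu (coords x) ∂μ := by
      rw [hΛ]; exact integral_congr_ae (ae_of_all _ fun x => by simp only [eH x, eΦGu x])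
    have cX : Continuous fun x => ∑ n : Edge 3 L × NoiseIdx (fundamentalLatticeRep 2).N, c n.1 * (w n (T - σ) x * wd n (T - σ) x) :=
      continuous_finsetSum _ fun n _ => continuous_const.mul ((cxw n _).mul (cxwd n _))
    have iA : Integrable (fun x => gen (gH s₁) x * Gu (coords x)) μ := hInt (cgenH.mul cGu)
    have iB : Integrable (fun x => gH s₁ (coords x) * (-2 * ∑ n : Edge 3 L × NoiseIdx (fundamentalLatticeRep 2).N, c n.1 * (w n (T - σ) x * wd n (T - σ) x))) μ :=
      hInt (cG.mul (continuous_const.mul cX))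
    have iC : Integrable (fun x => gH s₁ (coords x) * gen Gu x) μ := hInt (cG.mul cgenGu)
    have hΛdσ : Λd σ = ∫ x, (gH s₁ (coords x) * gen Gu x + gH s₁ (coords x) * (-2 * ∑ n : Edge 3 L × NoiseIdx (fundamentalLatticeRep 2).N, c n.1 * (w n (T - σ) x * wd n (T - σ) x))) ∂μ := by
      have hcomm : ∫ x, gen (gH s₁) x * Gu (coords x) ∂μ = ∫ x, Gu (coords x) * gen (gH s₁) x ∂μ :=
        integral_congr_ae (ae_of_all _ fun x => mul_comm _ _)
      calc Λd σ = ∫ x, (gen (gH s₁) x * Gu (coords x) + gH s₁ (coords x) * (-2 * ∑ n : Edge 3 L × NoiseIdx (fundamentalLatticeRep 2).N, c n.1 * (w n (T - σ) x * wd n (T - σ) x))) ∂μ := by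
            rw [hΛd]; exact integral_congr_ae (ae_of_all _ fun x => by simp only [eB x, eH x, eΦGu x, eΦd x])
        _ = ∫ x, gen (gH s₁) x * Gu (coords x) ∂μ + ∫ x, gH s₁ (coords x) * (-2 * ∑ n : Edge 3 L × NoiseIdx (fundamentalLatticeRep 2).N, c n.1 * (w n (T - σ) x * wd n (T - σ) x)) ∂μ :=
            integral_add iA iB
        _ = ∫ x, gH s₁ (coords x) * gen Gu x ∂μ + ∫ x, gH s₁ (coords x) * (-2 * ∑ n : Edge 3 L × NoiseIdx (fundamentalLatticeRep 2).N, c n.1 * (w n (T - σ) x * wd n (T - σ) x)) ∂μ := by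
            rw [hcomm, ← hsymm]
        _ = ∫ x, (gH s₁ (coords x) * gen Gu x + gH s₁ (coords x) * (-2 * ∑ n : Edge 3 L × NoiseIdx (fundamentalLatticeRep 2).N, c n.1 * (w n (T - σ) x * wd n (T - σ) x))) ∂μ :=
            (integral_add iC iB).symm
    rw [hΛσ, hΛdσ, ← integral_const_mul]
    refine integral_mono (hInt (continuous_const.mul (cG.mul cGu))) (iC.add iB) fun x => ?_
    have h := mul_le_mul_of_nonneg_left (hpt x) (hG0 x)
    rw [eΦGu x] at h
    show (2 - K₀) * (gH s₁ (coords x) * Gu (coords x)) ≤ _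
    linarith
  -- §6 Grönwall on `[0, T]`
  have hgron : Real.exp ((2 - K₀) * T) * Λ 0 ≤ Λ T := exp_mul_le_of_hasDerivAt_ge hT0 hΛc hΛder hkey
  -- §7 the endpoints
  have hTt : T.toNNReal = t := by rw [hT, Real.toNNReal_coe]
  have eW0 : ∀ n x, w n T x = fderiv ℝ g (coords x) (fun q : Edge 3 L × Fin (fundamentalLatticeRep 2).N × Fin (fundamentalLatticeRep 2).N × Bool => if n.1 = q.1 then (fun z : ℂ => if q.2.2.2 then z.im else z.re) (((Real.sqrt 2 : ℂ) • ((fundamentalLatticeRep 2).lieProj (noiseDir n.2) * (fun (ee : Edge 3 L) => Matrix.of fun (i j : Fin (fundamentalLatticeRep 2).N) => ((coords x (ee, i, j, false) : ℝ) : ℂ) + ((coords x (ee, i, j, true) : ℝ) : ℂ) * Complex.I) q.1)) q.2.1 q.2.2.1) else 0) := by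
    intro n x
    rw [hw]; dsimp only; rw [hTt, hs2 n (coords x)]
    exact frameDeriv_eq_of_comp_coords_eq (L := L) n ((hgF1 t).differentiable (by norm_num)) (hg.differentiable (by norm_num))
      (fun V => by show gF t (coords V) = g (coords V); rw [← hgFrep' t V, ← hgrep V]) x
  have eWT : ∀ n x, w n (T - T) x = fderiv ℝ f (coords x) (fun q : Edge 3 L × Fin (fundamentalLatticeRep 2).N × Fin (fundamentalLatticeRep 2).N × Bool => if n.1 = q.1 then (fun z : ℂ => if q.2.2.2 then z.im else z.re) (((Real.sqrt 2 : ℂ) • ((fundamentalLatticeRep 2).lieProj (noiseDir n.2) * (fun (ee : Edge 3 L) => Matrix.of fun (i j : Fin (fundamentalLatticeRep 2).N) => ((coords x (ee, i, j, false) : ℝ) : ℂ) + ((coords x (ee, i, j, true) : ℝ) : ℂ) * Complex.I) q.1)) q.2.1 q.2.2.1) else 0) := by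
    intro n x
    rw [hw]; dsimp only; rw [sub_self, hs2 n (coords x)]
    have cF : Continuous fun y : (GaugeConfig 3 L (Matrix.specialUnitaryGroup (Fin 2) ℂ)) => f (coords y) := hf.continuous.comp hco
    exact frameDeriv_eq_of_comp_coords_eq (L := L) n ((hgF1 _).differentiable (by norm_num)) (hf.differentiable (by norm_num))
      (fun V => by show gF (0 : ℝ).toNNReal (coords V) = f (coords V); rw [← hgFrep' _ V]; exact h0 cF V) x
  have hΛ0 : Λ 0 = ∫ x, h (coords x) * ∑ n : Edge 3 L × NoiseIdx (fundamentalLatticeRep 2).N, c n.1 * (fderiv ℝ g (coords x) (fun q : Edge 3 L × Fin (fundamentalLatticeRep 2).N × Fin (fundamentalLatticeRep 2).N × Bool => if n.1 = q.1 then (fun z : ℂ => if q.2.2.2 then z.im else z.re) (((Real.sqrt 2 : ℂ) • ((fundamentalLatticeRep 2).lieProj (noiseDir n.2) * (fun (ee : Edge 3 L) => Matrix.of fun (i j : Fin (fundamentalLatticeRep 2).N) => ((coords x (ee, i, j, false) : ℝ) : ℂ) + ((coords x (ee, i, j, true) : ℝ) : ℂ) * Complex.I) q.1)) q.2.1 q.2.2.1)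 else 0)) ^ 2 ∂μ := by
    rw [hΛ]
    refine integral_congr_ae (ae_of_all _ fun x => ?_)
    have eH : PH 0 x = h (coords x) := by rw [hPH]; exact h0 cH x
    show PH 0 x * _ = _
    simp only [sub_zero, eH, eW0, sq]
  have cΓ : Continuous fun y : (GaugeConfig 3 L (Matrix.specialUnitaryGroup (Fin 2) ℂ)) => ∑ n : Edge 3 L × NoiseIdx (fundamentalLatticeRep 2).N, c n.1 * (fderiv ℝ f (coords y) (fun q : Edge 3 L × Fin (fundamentalLatticeRep 2).N × Fin (fundamentalLatticeRep 2).N × Bool => if n.1 = q.1 then (fun z : ℂ => if q.2.2.2 then z.im else z.re) (((Real.sqrt 2 : ℂ) • ((fundamentalLatticeRep 2).lieProj (noiseDir n.2) * (fun (ee : Edge 3 L) => Matrix.of fun (i j : Fin (fundamentalLatticeRep 2).N) => ((coords y (ee, i, j, false) : ℝ) : ℂ) + ((coords y (ee, i, j, true) : ℝ) : ℂ) * Complex.I) q.1)) q.2.1 q.2.2.1) else 0)) ^ 2 := by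
    have e : (fun y : (GaugeConfig 3 L (Matrix.specialUnitaryGroup (Fin 2) ℂ)) => ∑ n : Edge 3 L × NoiseIdx (fundamentalLatticeRep 2).N, c n.1 * (fderiv ℝ f (coords y) (fun q : Edge 3 L × Fin (fundamentalLatticeRep 2).N × Fin (fundamentalLatticeRep 2).N × Bool => if n.1 = q.1 then (fun z : ℂ => if q.2.2.2 then z.im else z.re) (((Real.sqrt 2 : ℂ) • ((fundamentalLatticeRep 2).lieProj (noiseDir n.2) * (fun (ee : Edge 3 L) => Matrix.of fun (i j : Fin (fundamentalLatticeRep 2).N) => ((coords y (ee, i, j, false) : ℝ) : ℂ) + ((coords y (ee, i, j, true) : ℝ) : ℂ) * Complex.I) q.1)) q.2.1 q.2.2.1) else 0)) ^ 2) =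
        fun y => ∑ n : Edge 3 L × NoiseIdx (fundamentalLatticeRep 2).N, c n.1 * (w n (T - T) y * w n (T - T) y) := funext fun y => Finset.sum_congr rfl fun n _ => by rw [eWT n y, sq]
    rw [e]; exact cxΦ _
  have hΛT : Λ T = ∫ x, h (coords x) * (∫ y, ∑ n : Edge 3 L × NoiseIdx (fundamentalLatticeRep 2).N, c n.1 * (fderiv ℝ f (coords y) (fun q : Edge 3 L × Fin (fundamentalLatticeRep 2).N × Fin (fundamentalLatticeRep 2).N × Bool => if n.1 = q.1 then (fun z : ℂ => if q.2.2.2 then z.im else z.re) (((Real.sqrt 2 : ℂ) • ((fundamentalLatticeRep 2).lieProj (noiseDir n.2) * (fun (ee : Edge 3 L) => Matrix.of fun (i j : Fin (fundamentalLatticeRep 2).N) => ((coords y (ee, i, j, false) : ℝ) : ℂ) + ((coords y (ee, i, j, true) : ℝ) : ℂ) * Complex.I) q.1)) q.2.1 q.2.2.1) else 0)) ^ 2 ∂(κ t x)) ∂μ := by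
    have e1 : Λ T = ∫ x, (∑ n : Edge 3 L × NoiseIdx (fundamentalLatticeRep 2).N, c n.1 * (fderiv ℝ f (coords x) (fun q : Edge 3 L × Fin (fundamentalLatticeRep 2).N × Fin (fundamentalLatticeRep 2).N × Bool => if n.1 = q.1 then (fun z : ℂ => if q.2.2.2 then z.im else z.re) (((Real.sqrt 2 : ℂ) • ((fundamentalLatticeRep 2).lieProj (noiseDir n.2) * (fun (ee : Edge 3 L) => Matrix.of fun (i j : Fin (fundamentalLatticeRep 2).N) => ((coords x (ee, i, j, false) : ℝ) : ℂ) + ((coords x (ee, i, j, true) : ℝ) : ℂ) * Complex.I) q.1)) q.2.1 q.2.2.1) else 0)) ^ 2) * (∫ y, h (coords y) ∂(κ t x)) ∂μ := by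
      rw [hΛ]
      refine integral_congr_ae (ae_of_all _ fun x => ?_)
      have eH : PH T x = ∫ y, h (coords y) ∂(κ t x) := by rw [hPH]; dsimp only; rw [hTt]
      have eS : ∑ n : Edge 3 L × NoiseIdx (fundamentalLatticeRep 2).N, c n.1 * (w n (T - T) x * w n (T - T) x) = ∑ n : Edge 3 L × NoiseIdx (fundamentalLatticeRep 2).N, c n.1 * (fderiv ℝ f (coords x) (fun q : Edge 3 L × Fin (fundamentalLatticeRep 2).N × Fin (fundamentalLatticeRep 2).N × Bool => if n.1 = q.1 then (fun z : ℂ => if q.2.2.2 then z.im else z.re) (((Real.sqrt 2 : ℂ) • ((fundamentalLatticeRep 2).lieProj (noiseDir n.2) * (fun (ee : Edge 3 L) => Matrix.of fun (i j : Fin (fundamentalLatticeRep 2).N) => ((coords x (ee, i, j, false) : ℝ) : ℂ) + ((coords x (ee, i, j, true) : ℝ) : ℂ) * Complex.I) q.1)) q.2.1 q.2.2.1) else 0)) ^ 2 :=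
        Finset.sum_congr rfl fun n _ => by rw [eWT n x, sq]
      show PH T x * _ = _
      rw [eH, eS, mul_comm]
    rw [e1]
    exact integral_mul_transition_symm_su2 L β' κ hreal t cΓ cH
  rw [← hΛ0, ← hΛT]
  exact hgron

end Summit.QuantumFields.YangMills.Theorems.ColdStartUniversality
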